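import Summits.ABC.ABC.Theses.BelyiDegreeSmooth
import Literature.NumberTheory.DiophantineGeometry.BelyiPolynomialWitness

/-!
# `BelyiDegreeSmooth.BelyiTrivialBound` holds: Belyi's polynomial inhabits the inlined witness `W(c, a/c)`

Proof-only file over the CLOSED (retired) route ABC/BelyiDegreeSmooth, support item stmt-ABC-2248
`BelyiTrivialBound` ("[support — provable now; certifies that the inlined witness `W(d,t)` is inhabited at
`d = c`, i.e. `deg_B(a/c) ≤ c] BELYI'S MAP"): for every abc triple the normal form `W(c, a/c)` — coprime `p, q`
with `max (deg p) (deg q) = c`, a degree drop, `c + 1` distinct affine special points, `p·q·(p−q)` vanishing at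
`0, 1, a/c` — is inhabited. The inlined term IS `HasBelyiWitness c (a/c)` (`BelyiDegree.hasBelyiWitness_iff` is
`Iff.rfl`), proved for Belyi's polynomial `c^c x^a (1−x)^b/(a^a b^b)` in
`Literature/NumberTheory/DiophantineGeometry/BelyiPolynomialWitness.lean` (`IsABCTriple.hasBelyiWitness`).
Cell abc-iut, seat abc-iut-f-135 (gen 6); companion of `BelyiSqueezeDegBelyiRadicalOfABC.lean` (F-2686).
Nothing here asserts abc proved or refuted.
-/

set_option linter.dupNamespace false

namespace Summit.ABC.ABC.Theorems

open Literature.NumberTheory.DiophantineGeometry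

/-- **`BelyiTrivialBound` holds** (route ABC/BelyiDegreeSmooth, item stmt-ABC-2248; Belyĭ 1980 «deg_B(a/c) ≤ c»):
Belyi's polynomial is a degree-`c` witness `W(c, a/c)` for every abc triple. [cite: Belyi1980, §3] -/
theorem belyiTrivialBound_holds : Summit.ABC.ABC.Theses.BelyiDegreeSmooth.BelyiTrivialBound :=
  fun _ _ _ h => h.hasBelyiWitness

end Summit.ABC.ABC.Theorems
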